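import Literature.NumberTheory.LFunctions.ZetaCertifiedTablesFast
import Literature.NumberTheory.LFunctions.MertensConjectureDisproofAssembly
import Literature.NumberTheory.LFunctions.MertensCertificate
import HarnessLib

/-!
# The certified computation behind `limsup M(x)x^{-1/2} ≥ 1.6383` (Best–Trudgian 2015, Thm. 1): checkers and soundness

Topic `Literature/NumberTheory/LFunctions`. D. G. Best and T. S. Trudgian, *Linear relations of
zeroes of the zeta-function*, Math. Comp. 84 (2015) 2047–2058 [BestTrudgian2015], Theorem 1:
`limsup_{x→∞} M(x)x^{-1/2} ≥ 1.6383`, `liminf_{x→∞} M(x)x^{-1/2} ≤ -1.6383`. The printed proof is a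
multiprecision LLL computation (Theorem 4: the heaviest 500 of the first 2000 zeros to 9000 digits
are `{4976}`-independent) feeding the Anderson–Stark oscillation theorem. This file certifies the
SAME inequalities by the route of the tree's certified Odlyzko–te Riele computation
(`MertensCertificate.lean`), which is far cheaper to re-check inside Lean: by the kernel theorem of
Ingham and Jurkat–Peyerimhoff (`kernelTheorem_jurkatPeyerimhoff`, proved in the tree) it suffices
to exhibit two real numbers `y₊`, `y₋` with `Re h_K(y₊, T) > 1.6383` and `Re h_K(y₋, T) < -1.6383`,
`h_K(y,T) = Σ_{|γ|<T} k(γ/T) e^{iγy}/(ρζ'(ρ))`, `T = 2516` (so that the zero count `N(2516) = 2000`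
certified in `MertensCertificate/Top.lean` is reused), provided every zero with `|γ| < T` is simple
and on the line — which the certificate re-establishes from its own brackets and that count. The
numbers `y±` (integers of about 5000 bits) were found OUTSIDE Lean by lattice reduction on a
Hurst-type lattice (G. Hurst, Math. Comp. 87 (2018), §4) built from the 2000 zeros computed to 5170
bits; nothing of that search is trusted here.

## The checks (all data — 2000 centres `c_j` with `t₀ⱼ = c_j 2^{-5034}`, `y₊`, `y₋`, per-block
bounds — enter through a `CertData` record; they are verified, never trusted)

For each zero `j` (`zeroCheck`):
* one evaluation of `ζ(½ + it₀ⱼ)` by the certified Euler–Maclaurin evaluator `zetaBox`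
  (`ZetaCertifiedEvaluation.lean`) at scale `2^5110` (`N = 2300`, `ν = 1500`, about 1535 digits;
  tables from `mkTablesFast`);
* a rough `ζ'` from the slope of two evaluations at scale `2^200` at `t₀ⱼ ± 2^{-60}`
  (`norm_deriv_riemannZeta_sub_slope_le`), which also encloses `ζ'(½+iγ)` on the whole bracket;
* the Stirling main term of `θ` on the bracket and the rotated sign conditions of
  `hardyZ_mul_hardyZ_neg_of_center` (`HardyZSignCertificate.lean`): `Z(t₀ⱼ - r) Z(t₀ⱼ + r) < 0`,
  `r = 2^{-5030}`, hence a zero `½ + iγⱼ`, `|γⱼ - t₀ⱼ| ≤ r`;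
* enclosures of the summands `2 Re [k(γ/T) e^{iγy} / (ρ ζ'(ρ))]` at `y₊`, `y₋` valid for every `γ`
  in the bracket.
Per block of 50 zeros (`checkChunk`): ordering/separation of the brackets (`8 ≤ t₀ - r`,
`t₀ⱼ + r < t₀ⱼ₊₁ - r`, `t₀ + r < T`) and comparison of the summed enclosures with the claimed block
bounds; `checkFinal`: the claimed bounds add up to `> 1.6383` and `< -1.6383`.

## Main result

* `numerics_of_checks : Mertens.checkTop = true → checkFinal bnds = true → (∀ k < 40, checkChunk D (bnds k) k = true) →
  ∃ T > 0, (zeros below T simple, on the line) ∧ (∃ y, 1.6383 < Re h_K(y,T)) ∧ (∃ y, Re h_K(y,T) < -1.6383)`.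

The Bool checks are evaluated by `native_decide` in the block files `MertensCertificateBT/Chunk*.lean`;
`Literature/Barriers/RiemannHypothesis/MertensDisproofCert.lean` turns the result into
`BestTrudgian2015_thm1_holds`.

## References

* [BestTrudgian2015] D. G. Best, T. S. Trudgian, *Linear relations of zeroes of the zeta-function*,
  Math. Comp. 84 (2015), 2047–2058; arXiv:1209.3843 — Theorem 1.
* [OdlyzkoTeRiele1985] A. M. Odlyzko, H. J. J. te Riele, *Disproof of the Mertens conjecture*,
  J. reine angew. Math. 357 (1985), 138–160 — Theorem p. 144, §4.
* G. Hurst, *Computations of the Mertens function and improved bounds on the Mertens conjecture*,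
  Math. Comp. 87 (2018), 1013–1028; arXiv:1610.08551 — §4 (the lattice), §6.3.
-/

open Finset Complex
open Literature.Analysis.ValidatedNumerics.NumericsMP Literature.NumberTheory.LFunctions.ZetaNumerics
  Literature.NumberTheory.LFunctions Literature.NumberTheory.LFunctions.MertensZeroCertificate

namespace Literature.NumberTheory.LFunctions.ZetaNumerics.MertensBT

/-! ## Parameters -/

/-- Bits of the hi scale: `S = 2^5110`. [folklore] -/
def SB : ℕ := 5110

/-- Hi scale `S = 2^5110` (evaluations at the centres, the rotations, the summands). [folklore] -/
def S : ℕ := 2 ^ SB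

/-- Low scale `SD = 2^200` (the slope giving `ζ'`, the Stirling main term). [folklore] -/
def SD : ℕ := 2 ^ 200

/-- Bits of the centre grid: `t₀ⱼ = c_j / 2^5034`. [folklore] -/
def CB : ℕ := 5034

/-- Bits of the bracket half-width: `r = 2^{-5030} = 16 / 2^CB`. [folklore] -/
def RB : ℕ := 5030

/-- Tables for the hi evaluations: `N = 2300`, `ν = 1500` (error `< 2^{-5044}` for `t ≤ 2516`). [folklore] -/
def tabHi : Option Tables := mkTablesFast S 2300 1500 60 5200 1150 130 40 130 40

/-- Tables for the low evaluations: `N = 900`, `ν = 90`. [folklore] -/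
def tabLo : Option Tables := mkTablesFast SD 900 90 30 240 60 30 8 30 8

/-- Number of zeros. [folklore] -/
def NZ : ℕ := 2000

/-- Block length. [folklore] -/
def CHUNK : ℕ := 50

/-- Number of blocks. [folklore] -/
def NCHUNK : ℕ := 40

/-- The certificate data: centres `c_j` (`t₀ⱼ = c_j 2^{-CB}`) and the two integers `y₊`, `y₋`. (The
claimed per-block bounds `(L_k, U_k)` at scale `2^60` — `L_k 2^{-60} ≤ Σ_block (terms at y₊)`,
`Σ_block (terms at y₋) ≤ U_k 2^{-60}` — are passed to each block check separately.) [folklore] -/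
structure CertData where
  /-- centres, `t₀ⱼ = centers[j] / 2^CB` -/
  centers : Array ℕ
  /-- `y₊` (an integer) -/
  yPlus : ℤ
  /-- `y₋` (an integer) -/
  yMinus : ℤ

variable (D : CertData)

/-- The centre integer `c_j`. [folklore] -/
def ctr (j : ℕ) : ℕ := D.centers.getD j 0

/-- `t₀ⱼ = c_j / 2^CB`. [folklore] -/
noncomputable def t₀ (j : ℕ) : ℝ := (ctr D j : ℝ) / 2 ^ CB

/-- `r = 2^{-RB} = 16 / 2^{CB}`. [folklore] -/
noncomputable def rad : ℝ := 16 / 2 ^ CB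

/-- The kernel transform `k(t) = g(t/T₀)`, `T₀ = 2516`. [cite: OdlyzkoTeRiele1985, §4.1 (4.1) p. 150] -/
noncomputable def kT (t : ℝ) : ℂ := (jurkatPeyerimhoffKernel (t / Mertens.heightT0) : ℂ)

/-- The summand `2 Re [k(γ) e^{iγy} / (ρ ζ'(ρ))]` (twice the real part of `inghamTerm`). [cite: OdlyzkoTeRiele1985, Theorem p. 144] -/
noncomputable def term (y γ : ℝ) : ℝ := 2 * (inghamTerm kT y γ).re

/-! ## The checkers -/

/-- The exact interval `½` at scale `sc`. [folklore] -/
def halfAt (sc : ℕ) : MI := MI.ofFrac sc 1 2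

/-- Enclosure of `g(u)`, `u = γ/T₀`, for `γ` in `G` (`0 ≤ u ≤ 1`), at the hi scale. [cite: OdlyzkoTeRiele1985, §4.1 (4.1) p. 150] -/
def kernelBox (T : Tables) (G : MI) : Option MI :=
  let U := G.divNat Mertens.heightT0
  match MC.expI S T.KI T.kI T.piI (MI.mul S U T.piI) with
  | none => none
  | some E =>
    match MI.divPos S E.im T.piI with
    | none => none
    | some sdiv => some ((MI.mul S ((MI.ofInt S 1).sub U) E.re).add sdiv)

/-- Enclosure of `2 Re [e^{iγy} g / Den]` for `γ ∈ G`, `y` an integer, at the hi scale. [folklore] -/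
def termBox (T : Tables) (G g : MI) (Den : MC) (y : ℤ) : Option MI :=
  match MC.expI S T.KI T.kI T.piI (G.mulInt y) with
  | none => none
  | some E2 =>
    match MC.divBox S (E2.mulMI S g) Den with
    | none => none
    | some F => some (F.re.mulInt 2)

/-- The approximate centre on the `2^{-140}` grid: `u = ⌊c / 2^{CB-140}⌋`. [folklore] -/
def uOf (c : ℕ) : ℕ := c / 2 ^ (CB - 140)

/-- Widening of the slope (scale `SD`): `4 (T₀+5)³ 2^{141} ≥ (t₂-t₁) · 4(t₂+4)³ · SD` for `t₂ ≤ T₀ + 1`,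
`t₂ - t₁ = 2^{-59}`. [folklore] -/
def rSlope : ℤ := 4 * ((Mertens.heightT0 : ℤ) + 5) ^ 3 * 2 ^ 141

/-- The rough derivative: a box at scale `SD` containing `ζ'(½ + iγ)` for every `γ` with
`|γ - u 2^{-140}| ≤ 2^{-60}`, from the slope of `ζ` between `t₁ = u2^{-140} - 2^{-60}` and
`t₂ = u2^{-140} + 2^{-60}` (two low-precision evaluations). [folklore] -/
def derivBox (Tl : Tables) (u : ℕ) : Option MC :=
  match zetaBox Tl ⟨halfAt SD, MI.ofScaled (((u : ℤ) - 2 ^ 80) * 2 ^ 60)⟩,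
    zetaBox Tl ⟨halfAt SD, MI.ofScaled (((u : ℤ) + 2 ^ 80) * 2 ^ 60)⟩ with
  | some Z1, some Z2 => some ((MC.mulNegI ((Z2.sub Z1).mulInt (2 ^ 59))).widen rSlope)
  | _, _ => none

/-- The Stirling main term `M(t) = (t/2) log(t/2π) - t/2 - π/8` enclosed at scale `SD` over all `t`
with `t · 2^{140} ∈ [u-2, u+2]`, together with an upper bound `R` for `2K(¼)/t` there; returns
`(M, R)`. [cite: Titchmarsh1986, §4.17] -/
def stirlingBox (Tl : Tables) (u : ℕ) : Option (MI × MI) :=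
  let piI := Tl.piI
  match MI.logNat SD 240 (u - 2), MI.logNat SD 240 (u + 2), MI.logTwo SD 240,
    MI.divPos SD (MI.ofInt SD 3) piI with
  | some la, some lb, some l2, some q =>
    match MI.logNat SD 240 3, MI.logOneSub SD 240 ((MI.ofInt SD 1).sub q) with
    | some l3, some lq =>
      let lpi := l3.sub lq                                        -- log π
      let lt := (la.span lb).sub (l2.mulInt 140)                  -- log t
      let L := (lt.sub l2).sub lpi                                -- log (t/2π)
      let tI : MI := ⟨((u : ℤ) - 2) * 2 ^ 60, ((u : ℤ) + 2) * 2 ^ 60⟩   -- t at scale SD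
      let th := tI.divNat 2
      let M := ((MI.mul SD L th).sub th).sub (piI.divNat 8)
      let K := ((MI.ofFrac SD 1 6).add (MI.ofFrac SD 5 32)).add (piI.divNat 12)
      match MI.divPos SD (K.mulInt 2) (MI.lower tI) with
      | none => none
      | some R => some (M, R)
    | _, _ => none
  | _, _, _, _ => none

/-- The Stirling condition: with `φ = M.lo / SD`, `|φ - M(t)| + 2K/t < π/2` on the bracket, checked as
`2((M.hi - M.lo) + R.hi) < piI.lo`. [folklore] -/
def stirlingOk (Tl : Tables) (M R : MI) : Bool :=
  decide (2 * ((M.hi - M.lo) + R.hi) < Tl.piI.lo)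

/-- The rotated sign conditions of `hardyZ_mul_hardyZ_neg_of_center`, read at scale `S` (using
`E · S ≤ 1`): with `RD ∋ r ζ'` (from the low-scale box `DB`: `(d · SD)/2^{120} = r d S`),
`P₁ = e^{iφ}(W - i r D)`, `P₂ = e^{iφ}(W + i r D)`: `Re P₁ < -1/S ∧ 1/S < Re P₂` or the mirror image. [folklore] -/
def rotSignOk (Eφ W DB : MC) : Bool :=
  let RD : MC := ⟨DB.re.divNat (2 ^ 120), DB.im.divNat (2 ^ 120)⟩
  let P1 := MC.mul S Eφ (W.sub (MC.mulI RD))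
  let P2 := MC.mul S Eφ (W.add (MC.mulI RD))
  decide ((P1.re.hi < -1 ∧ 1 < P2.re.lo) ∨ (1 < P1.re.lo ∧ P2.re.hi < -1))

/-- The bounds `(lo, hi)` (scaled by `S`) of the summands at `y₊`, `y₋` over the bracket
`G = [c-16, c+16] / 2^CB`, the derivative ranging over the box `DB` (low scale, rescaled). [folklore] -/
def termsOf (Th : Tables) (c : ℕ) (DB : MC) (yP yM : ℤ) : Option (ℤ × ℤ) :=
  let G : MI := ⟨((c : ℤ) - 16) * 2 ^ (SB - CB), ((c : ℤ) + 16) * 2 ^ (SB - CB)⟩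
  let DBS : MC := ⟨MI.rescale SD S DB.re, MI.rescale SD S DB.im⟩
  let Den := MC.mul S ⟨halfAt S, G⟩ DBS
  match kernelBox Th G with
  | none => none
  | some g =>
    match termBox Th G g Den yP, termBox Th G g Den yM with
    | some FP, some FM => some (FP.lo, FM.hi)
    | _, _ => none

/-- The per-zero computation. From the centre integer `c`: the centre value `W ∋ ζ(½+it₀)` (hi scale),
the derivative box (low scale), the Stirling angle `φ = M.lo/SD` and its rotation `e^{iφ}` (hi scale),
the Stirling and sign conditions, and the bounds of the summands at `y₊`, `y₋` over the bracket.
`none` on any failure. [folklore] -/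
def zeroCheck (Th Tl : Tables) (c : ℕ) : Option (ℤ × ℤ) :=
  match zetaBox Th ⟨halfAt S, MI.ofScaled ((c : ℤ) * 2 ^ (SB - CB))⟩, derivBox Tl (uOf c),
    stirlingBox Tl (uOf c) with
  | some W, some DB, some (M, R) =>
    match MC.expI S Th.KI Th.kI Th.piI (MI.ofScaled (M.lo * 2 ^ (SB - 200))) with
    | some Eφ =>
      if stirlingOk Tl M R ∧ rotSignOk Eφ W DB then termsOf Th c DB D.yPlus D.yMinus else none
    | none => none
  | _, _, _ => none

/-- Ordering of the brackets: `8 ≤ t₀ⱼ - r`, `t₀ⱼ + r < T₀`, `t₀ⱼ + r < t₀ⱼ₊₁ - r` (if `j + 1 < 2000`),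
in integers (`r = 16 / 2^CB`). [folklore] -/
def orderOk (j : ℕ) : Bool :=
  decide (8 * 2 ^ CB + 16 ≤ ctr D j ∧ ctr D j + 16 < Mertens.heightT0 * 2 ^ CB ∧
    (j + 1 < NZ → ctr D j + 32 < ctr D (j + 1)))

/-- Accumulated sums `(Σ lo, Σ hi)` over the first `i` zeros of block `k`, `none` on any failure. [folklore] -/
def chunkSums (Th Tl : Tables) (k : ℕ) : ℕ → Option (ℤ × ℤ)
  | 0 => some (0, 0)
  | i + 1 =>
    match chunkSums Th Tl k i with
    | none => none
    | some (sl, sh) =>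
      if orderOk D (k * CHUNK + i) then
        match zeroCheck D Th Tl (ctr D (k * CHUNK + i)) with
        | some (vlo, vhi) => some (sl + vlo, sh + vhi)
        | none => none
      else none

/-- Comparison of the accumulated sums of a block with its claimed bounds `b = (L, U)` (scaled from
`2^60` to `S`). [folklore] -/
def boundsOk (b : ℤ × ℤ) : Option (ℤ × ℤ) → Bool
  | none => false
  | some (sl, sh) => decide (b.1 * 2 ^ (SB - 60) ≤ sl ∧ sh ≤ b.2 * 2 ^ (SB - 60))

/-- Block check with given tables. [folklore] -/
def checkChunkWith (Th Tl : Tables) (b : ℤ × ℤ) (k : ℕ) : Bool := boundsOk b (chunkSums D Th Tl k CHUNK)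

/-- **Block check `k` against the claimed bounds `b = (L_k, U_k)`** (evaluated only by
`native_decide`). [folklore] -/
def checkChunk (b : ℤ × ℤ) (k : ℕ) : Bool :=
  (tabHi.bind fun Th ↦ tabLo.map fun Tl ↦ checkChunkWith D Th Tl b k).getD false

/-- Sum of the claimed lower bounds. [folklore] -/
def sumL (bnds : ℕ → ℤ × ℤ) : ℤ := ∑ k ∈ Finset.range NCHUNK, (bnds k).1

/-- Sum of the claimed upper bounds. [folklore] -/
def sumU (bnds : ℕ → ℤ × ℤ) : ℤ := ∑ k ∈ Finset.range NCHUNK, (bnds k).2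

/-- **Final check**: `Σ L_k > 1.6383 · 2^60` and `Σ U_k < -1.6383 · 2^60`. [folklore] -/
def checkFinal (bnds : ℕ → ℤ × ℤ) : Bool :=
  decide (16383 * 2 ^ 60 < 10000 * sumL bnds ∧ 10000 * sumU bnds < -16383 * 2 ^ 60)

/-! ## Soundness -/

section Soundness

variable {D}

/-- [folklore] -/
lemma S_pos : 0 < S := by unfold S; positivity
/-- [folklore] -/
lemma SD_pos : 0 < SD := by unfold SD; positivity
/-- `S = 2^CB · 2^76`. [folklore] -/
lemma S_real : (S : ℝ) = 2 ^ CB * 2 ^ 76 := by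
  unfold S; rw [Nat.cast_pow, Nat.cast_ofNat, ← pow_add]; congr 1
/-- `S = 2^200 · 2^(SB-200)`. [folklore] -/
lemma S_real' : (S : ℝ) = 2 ^ 200 * 2 ^ (SB - 200) := by
  unfold S; rw [Nat.cast_pow, Nat.cast_ofNat, ← pow_add]; congr 1
/-- `S = 2^60 · 2^(SB-60)`. [folklore] -/
lemma S_real'' : (S : ℝ) = 2 ^ 60 * 2 ^ (SB - 60) := by
  unfold S; rw [Nat.cast_pow, Nat.cast_ofNat, ← pow_add]; congr 1
/-- `SD = 2^140 · 2^60`. [folklore] -/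
lemma SD_real : (SD : ℝ) = 2 ^ 140 * 2 ^ 60 := by
  unfold SD; rw [Nat.cast_pow, Nat.cast_ofNat, ← pow_add]
/-- `SD = 2^200`. [folklore] -/
lemma SD_real' : (SD : ℝ) = 2 ^ 200 := by unfold SD; rw [Nat.cast_pow, Nat.cast_ofNat]
/-- `2^CB = 2^140 · 2^(CB - 140)`. [folklore] -/
lemma twoCB_real : (2 : ℝ) ^ CB = 2 ^ 140 * 2 ^ (CB - 140) := by
  rw [← pow_add]; congr 1
/-- `2^(SB-CB) = 2^76`. [folklore] -/
lemma two_SB_CB : (2 : ℝ) ^ (SB - CB) = 2 ^ 76 := by congr 1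
/-- [folklore] -/
lemma NZ_pos : 0 < NZ := by unfold NZ; norm_num
/-- `144 ≤ CB`. [folklore] -/
lemma le_CB : 144 ≤ CB := by unfold CB; norm_num
/-- `2^140 · 2^(CB-140) = 2^CB` in `ℕ`. [folklore] -/
lemma CB_split : 2 ^ 140 * 2 ^ (CB - 140) = 2 ^ CB := by rw [← pow_add]; congr 1
/-- `2^CB` is large: `2^120 ≤ 2^CB`. [folklore] -/
lemma twoCB_ge : (2 : ℝ) ^ 120 ≤ 2 ^ CB := pow_le_pow_right₀ (by norm_num) (le_trans (by norm_num) le_CB)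
/-- [folklore] -/
lemma heightT0_real : (Mertens.heightT0 : ℝ) = 2516 := Mertens.heightT0_real
/-- [folklore] -/
lemma rad_pos : 0 < rad := by unfold rad; positivity
/-- `r ≤ 2^{-60}` (indeed `r = 2^{-5030}`). [folklore] -/
lemma rad_le : rad ≤ 1 / 2 ^ 64 := by
  unfold rad
  rw [div_le_div_iff₀ (by positivity) (by positivity), one_mul]
  calc (16 : ℝ) * 2 ^ 64 = 2 ^ 68 := by norm_num
    _ ≤ 2 ^ CB := pow_le_pow_right₀ (by norm_num) (le_trans (by norm_num) le_CB)

/-! The numerical parameters are huge powers of two: no tactic may ever evaluate them. -/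
attribute [irreducible] SB CB RB S SD

/-- Transport of interval membership between scales along an exact identity `x · S₁ = x' · S₂`.
[folklore] -/
lemma MI.mem_of_mul_eq {S₁ S₂ : ℕ} {x x' : ℝ} {I : MI} (h : MI.mem S₁ x I) (e : x * S₁ = x' * S₂) :
    MI.mem S₂ x' I := by
  rw [MI.mem_def] at h ⊢; rw [← e]; exact h

/-- The tables, when built, are valid. [folklore] -/
lemma tabHi_valid {T : Tables} (h : tabHi = some T) : T.Valid := mkTablesFast_valid h
/-- [folklore] -/
lemma tabHi_S {T : Tables} (h : tabHi = some T) : T.S = S := mkTablesFast_S h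
/-- [folklore] -/
lemma tabLo_valid {T : Tables} (h : tabLo = some T) : T.Valid := mkTablesFast_valid h
/-- [folklore] -/
lemma tabLo_S {T : Tables} (h : tabLo = some T) : T.S = SD := mkTablesFast_S h

attribute [irreducible] tabHi tabLo

/-! ### The kernel and the summands -/

/-- Soundness of `kernelBox`. [cite: OdlyzkoTeRiele1985, §4.1 (4.1) p. 150] -/
theorem mem_kernelBox {T : Tables} (hT : T.Valid) (hTS : T.S = S) {G g : MI}
    (h : kernelBox T G = some g) {γ : ℝ} (hγ : MI.mem S γ G) (h0 : 0 ≤ γ)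
    (h1 : γ ≤ Mertens.heightT0) : MI.mem S (jurkatPeyerimhoffKernel (γ / Mertens.heightT0)) g := by
  have hpi : MI.mem S Real.pi T.piI := hTS ▸ hT.mem_pi
  unfold kernelBox at h
  simp only at h
  split at h
  · simp at h
  · rename_i E hE
    split at h
    · simp at h
    · rename_i sdiv hsdiv
      simp only [Option.some.injEq] at h
      subst h
      set u : ℝ := γ / Mertens.heightT0 with hu
      have hU : MI.mem S u (G.divNat Mertens.heightT0) := MI.mem_divNat hγ Mertens.heightT0_pos
      have hΦ : MI.mem S (u * Real.pi) (MI.mul S (G.divNat Mertens.heightT0) T.piI) :=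
        MI.mem_mul S_pos hU hpi
      have hEm := MC.mem_expI S_pos hpi hE hΦ
      have hcos : MI.mem S (Real.cos (u * Real.pi)) E.re := by
        have := hEm.1; rwa [Complex.exp_ofReal_mul_I_re] at this
      have hsin : MI.mem S (Real.sin (u * Real.pi)) E.im := by
        have := hEm.2; rwa [Complex.exp_ofReal_mul_I_im] at this
      have hdiv := MI.mem_divPos S_pos hsdiv hsin hpi
      have hone : MI.mem S (((1 : ℤ) : ℝ) - u) ((MI.ofInt S 1).sub (G.divNat Mertens.heightT0)) :=
        MI.mem_sub (MI.mem_ofInt S 1) hU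
      have hres := MI.mem_add (MI.mem_mul S_pos hone hcos) hdiv
      have hT0 : (0 : ℝ) < Mertens.heightT0 := by rw [heightT0_real]; norm_num
      have hu0 : 0 ≤ u := div_nonneg h0 hT0.le
      have hu1 : u ≤ 1 := by rw [hu, div_le_one hT0]; exact h1
      have hval : jurkatPeyerimhoffKernel u =
          (((1 : ℤ) : ℝ) - u) * Real.cos (u * Real.pi) + Real.sin (u * Real.pi) / Real.pi := by
        unfold jurkatPeyerimhoffKernel
        rw [abs_of_nonneg hu0, if_pos hu1, mul_comm Real.pi u, Int.cast_one]
        ring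
      rw [hval]
      exact hres

/-- Soundness of `termBox`: for `γ ∈ G`, `gv ∈ g`, `w ∈ Den`, `2 Re [e^{iγy} gv / w] ∈ termBox`.
[folklore] -/
theorem mem_termBox {T : Tables} (hT : T.Valid) (hTS : T.S = S) {G g : MI} {Den : MC} {y : ℤ}
    {F : MI} (h : termBox T G g Den y = some F) {γ : ℝ} (hγ : MI.mem S γ G) {gv : ℝ}
    (hg : MI.mem S gv g) {w : ℂ} (hw : MC.mem S w Den) :
    MI.mem S ((cexp (((γ * (y : ℝ) : ℝ) : ℂ) * I) * (gv : ℂ) / w).re * 2) F := by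
  have hpi : MI.mem S Real.pi T.piI := hTS ▸ hT.mem_pi
  unfold termBox at h
  split at h
  · simp at h
  · rename_i E2 hE2
    split at h
    · simp at h
    · rename_i F' hF'
      simp only [Option.some.injEq] at h
      subst h
      have hΘ : MI.mem S (γ * (y : ℝ)) (G.mulInt y) := MI.mem_mulInt hγ y
      have hE := MC.mem_expI S_pos hpi hE2 hΘ
      have hP := MC.mem_mulMI S_pos hE hg
      have hF := MC.mem_divBox S_pos hF' hP hw
      exact MI.mem_mulInt hF.1 2

/-- The summand in the form produced by the checker. [folklore] -/
lemma term_eq (y : ℤ) (γ : ℝ) :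
    term y γ = (cexp (((γ * (y : ℝ) : ℝ) : ℂ) * I) * (jurkatPeyerimhoffKernel (γ / Mertens.heightT0) : ℂ) /
      ((1 / 2 + γ * I) * deriv riemannZeta (1 / 2 + γ * I))).re * 2 := by
  unfold term inghamTerm kT
  rw [mul_comm (2 : ℝ)]
  congr 3
  rw [mul_comm]
  congr 2
  push_cast; ring

/-! ### The rough derivative -/

/-- Membership of `½ + it` in the low-scale input boxes, `t = k / SD`. [folklore] -/
lemma mem_inputLo {k : ℤ} {t : ℝ} (ht : t = (k : ℝ) / SD) :
    MC.mem SD (1 / 2 + t * I) ⟨halfAt SD, MI.ofScaled k⟩ := by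
  have hre : ((1 : ℂ) / 2 + t * I).re = (1 : ℤ) / (2 : ℕ) := by simp
  have him : ((1 : ℂ) / 2 + t * I).im = t := by simp
  constructor
  · rw [hre]; exact MI.mem_ofFrac SD 1 (q := 2) (by norm_num)
  · rw [him, ht]; exact MI.mem_ofScaled SD_pos k

/-- Membership of `½ + it` in the hi-scale input boxes, `t = k / S`. [folklore] -/
lemma mem_inputHi {k : ℤ} {t : ℝ} (ht : t = (k : ℝ) / S) :
    MC.mem S (1 / 2 + t * I) ⟨halfAt S, MI.ofScaled k⟩ := by
  have hre : ((1 : ℂ) / 2 + t * I).re = (1 : ℤ) / (2 : ℕ) := by simp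
  have him : ((1 : ℂ) / 2 + t * I).im = t := by simp
  constructor
  · rw [hre]; exact MI.mem_ofFrac S 1 (q := 2) (by norm_num)
  · rw [him, ht]; exact MI.mem_ofScaled S_pos k

/-- **Soundness of `derivBox`**: for `8·2^{140} ≤ u < T₀·2^{140}` and every `γ` with
`|γ - u 2^{-140}| ≤ 2^{-60}`, `ζ'(½ + iγ) ∈ derivBox` (slope of `ζ` plus the explicit error
`(t₂-t₁)·4(t₂+4)³`, `norm_deriv_riemannZeta_sub_slope_le`). [folklore] -/
theorem mem_derivBox {Tl : Tables} (hT : Tl.Valid) (hTS : Tl.S = SD) {u : ℕ}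
    (hu8 : 8 * 2 ^ 140 ≤ u) (huT : u < Mertens.heightT0 * 2 ^ 140) {DB : MC}
    (h : derivBox Tl u = some DB) {γ : ℝ} (hγ : |γ - (u : ℝ) / 2 ^ 140| ≤ 1 / 2 ^ 60) :
    MC.mem SD (deriv riemannZeta (1 / 2 + γ * I)) DB := by
  set t₁ : ℝ := (u : ℝ) / 2 ^ 140 - 1 / 2 ^ 60 with ht₁
  set t₂ : ℝ := (u : ℝ) / 2 ^ 140 + 1 / 2 ^ 60 with ht₂
  have h2p : (0 : ℝ) < 2 ^ 140 := pow_pos (by norm_num) _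
  have hu8r : (8 : ℝ) * 2 ^ 140 ≤ u := by exact_mod_cast hu8
  have huTr : (u : ℝ) < Mertens.heightT0 * 2 ^ 140 := by exact_mod_cast huT
  have hu8' : 8 ≤ (u : ℝ) / 2 ^ 140 := by rw [le_div_iff₀ h2p]; exact hu8r
  have huT' : (u : ℝ) / 2 ^ 140 < Mertens.heightT0 := by rw [div_lt_iff₀ h2p]; exact huTr
  have h60 : (0 : ℝ) < 1 / 2 ^ 60 := by positivity
  have h60' : (1 : ℝ) / 2 ^ 60 ≤ 1 := by
    rw [div_le_one (pow_pos (by norm_num) _)]; exact one_le_pow₀ (by norm_num)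
  have ht1 : 2 ≤ t₁ := by rw [ht₁]; linarith
  have ht12 : t₁ < t₂ := by rw [ht₁, ht₂]; linarith
  have hgap : t₂ - t₁ = 1 / 2 ^ 59 := by
    rw [ht₁, ht₂, show (2 : ℝ) ^ 60 = 2 ^ 59 * 2 by norm_num]; field_simp; ring
  have ht2T : t₂ < Mertens.heightT0 + 1 := by rw [ht₂]; linarith
  have hγI : γ ∈ Set.Icc t₁ t₂ := by
    rw [ht₁, ht₂]; constructor <;> linarith [(abs_le.1 hγ).1, (abs_le.1 hγ).2]
  have hs1 : (1 / 2 : ℂ) + t₁ * I ≠ 1 := fun h ↦ by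
    have := congrArg Complex.im h; simp at this; linarith
  have hs2 : (1 / 2 : ℂ) + t₂ * I ≠ 1 := fun h ↦ by
    have := congrArg Complex.im h; simp at this; linarith
  have e2 : (2 : ℝ) ^ 200 = 2 ^ 140 * 2 ^ 60 := by norm_num
  have e3 : (2 : ℝ) ^ 140 = 2 ^ 80 * 2 ^ 60 := by norm_num
  have hin1 : MC.mem Tl.S (1 / 2 + t₁ * I) ⟨halfAt SD, MI.ofScaled (((u : ℤ) - 2 ^ 80) * 2 ^ 60)⟩ := by
    rw [hTS]; apply mem_inputLo
    rw [ht₁, SD_real', e2, e3]; push_cast; field_simp; ring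
  have hin2 : MC.mem Tl.S (1 / 2 + t₂ * I) ⟨halfAt SD, MI.ofScaled (((u : ℤ) + 2 ^ 80) * 2 ^ 60)⟩ := by
    rw [hTS]; apply mem_inputLo
    rw [ht₂, SD_real', e2, e3]; push_cast; field_simp; ring
  unfold derivBox at h
  split at h
  · rename_i Z1 Z2 hZ1 hZ2
    simp only [Option.some.injEq] at h
    subst h
    have hm1 := mem_zetaBox hT hin1 hs1 hZ1
    have hm2 := mem_zetaBox hT hin2 hs2 hZ2
    rw [hTS] at hm1 hm2
    have hslope := norm_deriv_riemannZeta_sub_slope_le ht1 ht12 hγI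
    have hD0 : MC.mem SD ((riemannZeta (1 / 2 + t₂ * I) - riemannZeta (1 / 2 + t₁ * I)) /
        ((t₂ - t₁ : ℝ) * I)) (MC.mulNegI ((Z2.sub Z1).mulInt (2 ^ 59))) := by
      have := MC.mem_mulNegI (MC.mem_mulInt (MC.mem_sub hm2 hm1) (2 ^ 59))
      convert this using 1
      rw [hgap, div_eq_mul_inv, mul_inv, Complex.inv_I]
      push_cast
      ring
    apply MC.mem_widen hD0
    refine (mul_le_mul_of_nonneg_right hslope (by positivity)).trans ?_
    rw [hgap, SD_real']
    unfold rSlope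
    push_cast
    have h4 : 0 ≤ t₂ + 4 := by linarith
    have hc : (t₂ + 4) ^ 3 ≤ ((Mertens.heightT0 : ℝ) + 5) ^ 3 :=
      pow_le_pow_left₀ h4 (by linarith) 3
    have : (1 : ℝ) / 2 ^ 59 * (4 * (t₂ + 4) ^ 3) * 2 ^ 200 = 4 * (t₂ + 4) ^ 3 * 2 ^ 141 := by
      rw [show (2 : ℝ) ^ 200 = 2 ^ 59 * 2 ^ 141 by norm_num]; field_simp
    rw [this]
    have h141 : (0 : ℝ) ≤ 2 ^ 141 := by positivity
    nlinarith [hc]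
  · simp at h

/-! ### The Stirling angle -/

/-- **Soundness of `stirlingBox` / `stirlingOk`**: for `u ≥ 8 · 2^{140}`, if the check passes then
for every `t` with `t · 2^{140} ∈ [u - 2, u + 2]`, with `φ = M.lo / SD`,
`|φ - ((t/2) log(t/2π) - t/2 - π/8)| + 2K(¼)/t < π/2`. [cite: Titchmarsh1986, §4.17] -/
theorem stirling_sound {Tl : Tables} (hT : Tl.Valid) (hTS : Tl.S = SD) {u : ℕ}
    (hu8 : 8 * 2 ^ 140 ≤ u) {M R : MI} (h : stirlingBox Tl u = some (M, R))
    (hok : stirlingOk Tl M R = true) {t : ℝ}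
    (ht : (u : ℝ) - 2 ≤ t * 2 ^ 140 ∧ t * 2 ^ 140 ≤ (u : ℝ) + 2) :
    |(M.lo : ℝ) / SD - (t / 2 * Real.log (t / (2 * Real.pi)) - t / 2 - Real.pi / 8)| +
      2 * stirlingVertRate (1 / 4) / t < Real.pi / 2 := by
  have hpi : MI.mem SD Real.pi Tl.piI := hTS ▸ hT.mem_pi
  have hSr : (0 : ℝ) < SD := by exact_mod_cast SD_pos
  have h2p : (0 : ℝ) < 2 ^ 140 := pow_pos (by norm_num) _
  have hu8r : (8 : ℝ) * 2 ^ 140 ≤ u := by exact_mod_cast hu8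
  have hu2 : 2 ≤ u := le_trans (by norm_num) (le_trans (Nat.le_mul_of_pos_right 8 (pow_pos (by norm_num) 140)) hu8)
  -- `v = t 2^140 ∈ [u-2, u+2]`, all positive
  set v : ℝ := t * 2 ^ 140 with hv
  have hv0 : 0 < v := by rw [hv]; linarith
  have ht0 : 0 < t := by
    by_contra h0; push Not at h0
    have : v ≤ 0 := by rw [hv]; exact mul_nonpos_of_nonpos_of_nonneg h0 h2p.le
    linarith
  have htv : t = v / 2 ^ 140 := by rw [hv]; field_simp
  unfold stirlingBox at h
  simp only at h
  split at h
  · rename_i la lb l2 q hla hlb hl2 hq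
    split at h
    · rename_i l3 lq hl3 hlq
      split at h
      · simp at h
      · rename_i R' hR'
        simp only [Option.some.injEq, Prod.mk.injEq] at h
        obtain ⟨hM, hR⟩ := h
        -- logarithms
        have hla' := MI.mem_logNat SD_pos hla
        have hlb' := MI.mem_logNat SD_pos hlb
        have hl2' := MI.mem_logTwo SD_pos hl2
        have hl3' := MI.mem_logNat SD_pos hl3
        have hum : ((u - 2 : ℕ) : ℝ) = (u : ℝ) - 2 := by
          rw [Nat.cast_sub hu2]; norm_num
        rw [hum] at hla'
        have hup : ((u + 2 : ℕ) : ℝ) = (u : ℝ) + 2 := by push_cast; ring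
        rw [hup] at hlb'
        have hum0 : (0 : ℝ) < (u : ℝ) - 2 := by linarith
        have hlogv : MI.mem SD (Real.log v) (la.span lb) :=
          MI.mem_span hla' hlb' (Real.log_le_log hum0 ht.1) (Real.log_le_log hv0 ht.2)
        have hlogt : MI.mem SD (Real.log t) ((la.span lb).sub (l2.mulInt 140)) := by
          have := MI.mem_sub hlogv (MI.mem_mulInt hl2' 140)
          convert this using 1
          rw [htv, Real.log_div hv0.ne' (by positivity), Real.log_pow]; push_cast; ring
        have h3pi : MI.mem SD ((3 : ℝ) / Real.pi) q := by
          have := MI.mem_divPos SD_pos hq (MI.mem_ofInt SD 3) hpi; simpa using this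
        have hx : MI.mem SD (1 - 3 / Real.pi) ((MI.ofInt SD 1).sub q) := by
          have := MI.mem_sub (MI.mem_ofInt SD 1) h3pi
          have e : ((1 : ℤ) : ℝ) = 1 := Int.cast_one
          rw [e] at this; exact this
        have hlq' := MI.mem_logOneSub SD_pos hlq hx
        have hpi0 : 0 < Real.pi := Real.pi_pos
        have elq : Real.log (1 - (1 - 3 / Real.pi)) = Real.log 3 - Real.log Real.pi := by
          rw [show (1 : ℝ) - (1 - 3 / Real.pi) = 3 / Real.pi by ring,
            Real.log_div (by norm_num) hpi0.ne']
        rw [elq] at hlq'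
        have hlpi : MI.mem SD (Real.log Real.pi) (l3.sub lq) := by
          have := MI.mem_sub hl3' hlq'
          convert this using 1; push_cast; ring
        have hL : MI.mem SD (Real.log (t / (2 * Real.pi)))
            ((((la.span lb).sub (l2.mulInt 140)).sub l2).sub (l3.sub lq)) := by
          have := MI.mem_sub (MI.mem_sub hlogt hl2') hlpi
          convert this using 1
          rw [Real.log_div ht0.ne' (by positivity), Real.log_mul (by norm_num) hpi0.ne']
          ring
        -- `t` and `t/2`
        have htI : MI.mem SD t ⟨((u : ℤ) - 2) * 2 ^ 60, ((u : ℤ) + 2) * 2 ^ 60⟩ := by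
          rw [MI.mem_def, SD_real]
          push_cast
          constructor <;> nlinarith [ht.1, ht.2]
        have hth : MI.mem SD (t / 2) (MI.divNat ⟨((u : ℤ) - 2) * 2 ^ 60, ((u : ℤ) + 2) * 2 ^ 60⟩ 2) :=
          MI.mem_divNat htI (n := 2) (by norm_num)
        set Mv : ℝ := t / 2 * Real.log (t / (2 * Real.pi)) - t / 2 - Real.pi / 8 with hMv
        have hMm : MI.mem SD Mv M := by
          rw [← hM]
          have := MI.mem_sub (MI.mem_sub (MI.mem_mul SD_pos hL hth) hth) (MI.mem_divNat hpi (n := 8) (by norm_num))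
          convert this using 1
          rw [hMv]; ring
        have hK : MI.mem SD (stirlingVertRate (1 / 4))
            (((MI.ofFrac SD 1 6).add (MI.ofFrac SD 5 32)).add (Tl.piI.divNat 12)) := by
          have := MI.mem_add (MI.mem_add (MI.mem_ofFrac SD 1 (q := 6) (by norm_num))
            (MI.mem_ofFrac SD 5 (q := 32) (by norm_num))) (MI.mem_divNat hpi (n := 12) (by norm_num))
          convert this using 1
          unfold stirlingVertRate; push_cast; ring
        -- the lower endpoint of the `t`-interval as a real number
        set tlo : ℝ := ((((u : ℤ) - 2) * 2 ^ 60 : ℤ) : ℝ) / SD with htlo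
        have htlo_pos : 0 < tlo := by
          rw [htlo, SD_real]; push_cast
          apply div_pos _ (by positivity)
          nlinarith
        have htlo_le : tlo ≤ t := by
          rw [htlo, div_le_iff₀ hSr, SD_real]; push_cast; nlinarith [ht.1]
        have hRm : MI.mem SD (2 * stirlingVertRate (1 / 4) / tlo) R := by
          rw [← hR]
          have := MI.mem_divPos SD_pos hR' (MI.mem_mulInt hK 2) (MI.mem_lower SD_pos _)
          convert this using 1; rw [htlo]; push_cast; ring
        have hK0 : 0 ≤ stirlingVertRate (1 / 4) := by unfold stirlingVertRate; positivity
        have hRt : 2 * stirlingVertRate (1 / 4) / t ≤ 2 * stirlingVertRate (1 / 4) / tlo :=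
          div_le_div_of_nonneg_left (by positivity) htlo_pos htlo_le
        -- read off the check
        have hdec : 2 * ((M.hi - M.lo) + R.hi) < Tl.piI.lo := of_decide_eq_true hok
        have hdec' : (2 : ℝ) * ((M.hi - M.lo) + R.hi) < Tl.piI.lo := by exact_mod_cast hdec
        have hpilo : (Tl.piI.lo : ℝ) ≤ Real.pi * SD := hpi.1
        have hM1 := hMm.1
        have hM2 := hMm.2
        have hR2 := hRm.2
        have habs : |(M.lo : ℝ) / SD - Mv| * SD ≤ (M.hi : ℝ) - M.lo := by
          rw [abs_sub_comm, abs_of_nonneg (by rw [sub_nonneg, div_le_iff₀ hSr]; exact hM1)]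
          rw [sub_mul, div_mul_cancel₀ _ hSr.ne']
          linarith
        have hRle : 2 * stirlingVertRate (1 / 4) / t * SD ≤ R.hi := by
          have := mul_le_mul_of_nonneg_right hRt hSr.le
          linarith
        have key : (|(M.lo : ℝ) / SD - Mv| + 2 * stirlingVertRate (1 / 4) / t) * SD < Real.pi / 2 * SD := by
          rw [add_mul]; nlinarith
        exact lt_of_mul_lt_mul_right key hSr.le
    · simp at h
  · simp at h

/-! ### One zero -/

/-- Soundness of `rotSignOk`: if `e ∈ Eφ`, `w ∈ W` (scale `S`), `d ∈ DB` (scale `SD`), then with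
`rd = rad · d`: `Re (e (w - i rd)) · S < -1 ∧ 1 < Re (e (w + i rd)) · S`, or the mirror image. [folklore] -/
theorem rotSignOk_sound {Eφ W DB : MC} (h : rotSignOk Eφ W DB = true) {e w d : ℂ}
    (he : MC.mem S e Eφ) (hw : MC.mem S w W) (hd : MC.mem SD d DB) :
    ((e * (w - rad * I * d)).re * S < -1 ∧ 1 < (e * (w + rad * I * d)).re * S) ∨
      (1 < (e * (w - rad * I * d)).re * S ∧ (e * (w + rad * I * d)).re * S < -1) := by
  have hdec := of_decide_eq_true h
  -- `rad · d` at scale `S`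
  have e80 : (2 : ℝ) ^ 200 = 2 ^ 120 * 2 ^ 80 := by norm_num
  have hRD : MC.mem S ((rad : ℂ) * d) ⟨DB.re.divNat (2 ^ 120), DB.im.divNat (2 ^ 120)⟩ := by
    have hsc : ∀ x : ℝ, x / (2 ^ 120 : ℕ) * SD = rad * x * S := fun x ↦ by
      rw [SD_real', S_real, e80]; unfold rad; push_cast; field_simp; ring
    have hre : ((rad : ℂ) * d).re = rad * d.re := by simp
    have him : ((rad : ℂ) * d).im = rad * d.im := by simp
    constructor
    · have := MI.mem_divNat hd.1 (n := 2 ^ 120) (by positivity)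
      refine MI.mem_of_mul_eq this ?_
      rw [hsc, hre]
    · have := MI.mem_divNat hd.2 (n := 2 ^ 120) (by positivity)
      refine MI.mem_of_mul_eq this ?_
      rw [hsc, him]
  have hrdI := MC.mem_mulI hRD
  have hm : MC.mem S (w - rad * I * d) (W.sub (MC.mulI ⟨DB.re.divNat (2 ^ 120), DB.im.divNat (2 ^ 120)⟩)) := by
    have := MC.mem_sub hw hrdI; convert this using 1; ring
  have hp : MC.mem S (w + rad * I * d) (W.add (MC.mulI ⟨DB.re.divNat (2 ^ 120), DB.im.divNat (2 ^ 120)⟩)) := by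
    have := MC.mem_add hw hrdI; convert this using 1; ring
  have hP1 := (MC.mem_mul S_pos he hm).1
  have hP2 := (MC.mem_mul S_pos he hp).1
  rw [MI.mem_def] at hP1 hP2
  rcases hdec with ⟨h1, h2⟩ | ⟨h1, h2⟩
  · left
    have h1' : ((MC.mul S Eφ (W.sub (MC.mulI ⟨DB.re.divNat (2 ^ 120), DB.im.divNat (2 ^ 120)⟩))).re.hi : ℝ) < -1 := by
      exact_mod_cast h1
    have h2' : (1 : ℝ) < (MC.mul S Eφ (W.add (MC.mulI ⟨DB.re.divNat (2 ^ 120), DB.im.divNat (2 ^ 120)⟩))).re.lo := by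
      exact_mod_cast h2
    exact ⟨by linarith [hP1.2], by linarith [hP2.1]⟩
  · right
    have h1' : (1 : ℝ) < (MC.mul S Eφ (W.sub (MC.mulI ⟨DB.re.divNat (2 ^ 120), DB.im.divNat (2 ^ 120)⟩))).re.lo := by
      exact_mod_cast h1
    have h2' : ((MC.mul S Eφ (W.add (MC.mulI ⟨DB.re.divNat (2 ^ 120), DB.im.divNat (2 ^ 120)⟩))).re.hi : ℝ) < -1 := by
      exact_mod_cast h2
    exact ⟨by linarith [hP1.1], by linarith [hP2.2]⟩

/-- Soundness of `termsOf`: for every `γ` in the bracket `[(c-16)/2^CB, (c+16)/2^CB]` (with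
`0 ≤ γ ≤ T₀`) whose derivative `ζ'(½+iγ)` lies in `DB` (low scale), the summands at `yP`, `yM` are
bounded by `lo/S`, `hi/S`. [folklore] -/
theorem termsOf_sound {Th : Tables} (hT : Th.Valid) (hTS : Th.S = S) {c : ℕ} {DB : MC} {yP yM : ℤ}
    {vlo vhi : ℤ} (h : termsOf Th c DB yP yM = some (vlo, vhi)) {γ : ℝ}
    (hγ : γ ∈ Set.Icc (((c : ℝ) - 16) / 2 ^ CB) (((c : ℝ) + 16) / 2 ^ CB)) (hγ0 : 0 ≤ γ)
    (hγT : γ ≤ Mertens.heightT0) (hD : MC.mem SD (deriv riemannZeta (1 / 2 + γ * I)) DB) :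
    (vlo : ℝ) ≤ term yP γ * S ∧ term yM γ * S ≤ vhi := by
  have hA : (0 : ℝ) < 2 ^ CB := pow_pos (by norm_num) _
  unfold termsOf at h
  simp only at h
  split at h
  · simp at h
  · rename_i g hg
    split at h
    · rename_i FP FM hFP hFM
      simp only [Option.some.injEq, Prod.mk.injEq] at h
      obtain ⟨rfl, rfl⟩ := h
      have hG : MI.mem S γ ⟨((c : ℤ) - 16) * 2 ^ (SB - CB), ((c : ℤ) + 16) * 2 ^ (SB - CB)⟩ := by
        rw [MI.mem_def, S_real]
        push_cast
        rw [two_SB_CB]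
        obtain ⟨h1, h2⟩ := hγ
        rw [div_le_iff₀ hA] at h1
        rw [le_div_iff₀ hA] at h2
        have h76 : (0 : ℝ) ≤ 2 ^ 76 := by positivity
        constructor
        · have := mul_le_mul_of_nonneg_right h1 h76; linarith
        · have := mul_le_mul_of_nonneg_right h2 h76; linarith
      have hDBS : MC.mem S (deriv riemannZeta (1 / 2 + γ * I)) ⟨MI.rescale SD S DB.re, MI.rescale SD S DB.im⟩ :=
        ⟨MI.mem_rescale SD_pos S hD.1, MI.mem_rescale SD_pos S hD.2⟩
      have hρ : MC.mem S ((1 / 2 : ℂ) + γ * I) ⟨halfAt S, ⟨((c : ℤ) - 16) * 2 ^ (SB - CB), ((c : ℤ) + 16) * 2 ^ (SB - CB)⟩⟩ := by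
        constructor
        · have := MI.mem_ofFrac S 1 (q := 2) (by norm_num)
          simp only [halfAt]
          convert this using 1; simp
        · simpa using hG
      have hDen := MC.mem_mul S_pos hρ hDBS
      have hgm := mem_kernelBox hT hTS hg hG hγ0 hγT
      have hP := mem_termBox hT hTS hFP hG hgm hDen
      have hM := mem_termBox hT hTS hFM hG hgm hDen
      constructor
      · have := hP.1; rw [term_eq]; exact this
      · have := hM.2; rw [term_eq]; exact this
    · simp at h

/-- `E · S ≤ 1` for the Taylor error `E = 2(t₀+15)³ r²` of `hardyZ_mul_hardyZ_neg_of_center`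
(`t₀ ≤ 2516`, `r = 16/2^CB`, `S = 2^CB · 2^76`). [folklore] -/
lemma errE_mul_S_le {t : ℝ} (ht0 : 0 ≤ t) (ht : t ≤ 2516) :
    2 * (t + 15) ^ 3 * rad ^ 2 * S ≤ 1 := by
  have hA : (0 : ℝ) < 2 ^ CB := pow_pos (by norm_num) _
  have hcube : (t + 15) ^ 3 ≤ 2 ^ 34 := by
    calc (t + 15) ^ 3 ≤ (2531 : ℝ) ^ 3 := pow_le_pow_left₀ (by linarith) (by linarith) 3
      _ ≤ 2 ^ 34 := by norm_num
  have e : 2 * (t + 15) ^ 3 * rad ^ 2 * S = 2 * (t + 15) ^ 3 * 2 ^ 84 / 2 ^ CB := by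
    unfold rad; rw [S_real]; field_simp; ring
  rw [e, div_le_one hA]
  calc 2 * (t + 15) ^ 3 * (2 : ℝ) ^ 84 ≤ 2 * 2 ^ 34 * 2 ^ 84 := by nlinarith [pow_pos (show (0:ℝ) < 2 by norm_num) 84]
    _ = 2 ^ 119 := by norm_num
    _ ≤ 2 ^ CB := pow_le_pow_right₀ (by norm_num) (le_trans (by norm_num) le_CB)

/-- **Soundness of the per-zero computation.** With `t₀ = c/2^CB`, `8 ≤ t₀ - r`, `t₀ + r < T₀`:
a passed `zeroCheck` certifies `Z(t₀ - r) Z(t₀ + r) < 0` and bounds the summands at `y₊`, `y₋` by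
`lo/S`, `hi/S` for every `γ` in the bracket. [folklore] -/
theorem zeroCheck_sound {Th Tl : Tables} (hTh : Th.Valid) (hThS : Th.S = S) (hTl : Tl.Valid)
    (hTlS : Tl.S = SD) {c : ℕ} (hc8 : 8 * 2 ^ CB + 16 ≤ c) (hcT : c + 16 < Mertens.heightT0 * 2 ^ CB)
    {vlo vhi : ℤ} (h : zeroCheck D Th Tl c = some (vlo, vhi)) :
    hardyZ ((c : ℝ) / 2 ^ CB - rad) * hardyZ ((c : ℝ) / 2 ^ CB + rad) < 0 ∧
      ∀ γ ∈ Set.Icc ((c : ℝ) / 2 ^ CB - rad) ((c : ℝ) / 2 ^ CB + rad),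
        (vlo : ℝ) ≤ term D.yPlus γ * S ∧ term D.yMinus γ * S ≤ vhi := by
  -- real-number bookkeeping
  set A : ℝ := 2 ^ CB with hAdef
  have hA : 0 < A := pow_pos (by norm_num) _
  set t0 : ℝ := (c : ℝ) / A with ht0def
  have hrad : rad = 16 / A := rfl
  have hc8r : (8 : ℝ) * A + 16 ≤ c := by rw [hAdef]; exact_mod_cast hc8
  have hcTr : (c : ℝ) + 16 < Mertens.heightT0 * A := by rw [hAdef]; exact_mod_cast hcT
  have ht0m : 8 ≤ t0 - rad := by
    rw [ht0def, hrad, ← sub_div, le_div_iff₀ hA]; linarith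
  have ht0p : t0 + rad < Mertens.heightT0 := by
    rw [ht0def, hrad, ← add_div, div_lt_iff₀ hA]; linarith
  have hT0 : (Mertens.heightT0 : ℝ) = 2516 := heightT0_real
  have h8t0 : 8 ≤ t0 := by linarith [rad_pos]
  -- the grid point `u`
  set u : ℕ := uOf c with hudef
  have hB : (0 : ℝ) < 2 ^ 140 := pow_pos (by norm_num) _
  have hpowCB : 2 ^ 140 * 2 ^ (CB - 140) = 2 ^ CB := CB_split
  have hb0 : 0 < 2 ^ (CB - 140) := pow_pos (by norm_num) _
  have hu1 : u * 2 ^ (CB - 140) ≤ c := by rw [hudef]; exact Nat.div_mul_le_self c _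
  have hu2 : c < (u + 1) * 2 ^ (CB - 140) := by
    rw [hudef, mul_comm]; unfold uOf; exact Nat.lt_mul_div_succ c hb0
  have hu8 : 8 * 2 ^ 140 ≤ u := by
    rw [hudef]; unfold uOf
    rw [Nat.le_div_iff_mul_le hb0, mul_assoc, hpowCB]
    omega
  have huT : u < Mertens.heightT0 * 2 ^ 140 := by
    rw [hudef]; unfold uOf
    rw [Nat.div_lt_iff_lt_mul hb0, mul_assoc, hpowCB]
    omega
  have hAB : A = 2 ^ 140 * 2 ^ (CB - 140) := by rw [hAdef]; exact twoCB_real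
  have hB' : (0 : ℝ) < 2 ^ (CB - 140) := pow_pos (by norm_num) _
  have hu1r : (u : ℝ) * 2 ^ (CB - 140) ≤ c := by exact_mod_cast hu1
  have hu2r : (c : ℝ) < ((u : ℝ) + 1) * 2 ^ (CB - 140) := by exact_mod_cast hu2
  -- `0 ≤ t0 - u/2^140 < 2^-140`
  have hgrid1 : (u : ℝ) / 2 ^ 140 ≤ t0 := by
    have e : (u : ℝ) / 2 ^ 140 = ((u : ℝ) * 2 ^ (CB - 140)) / A := by
      rw [hAB]; field_simp
    rw [e, ht0def]
    exact div_le_div_of_nonneg_right hu1r hA.le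
  have hgrid2 : t0 ≤ (u : ℝ) / 2 ^ 140 + 1 / 2 ^ 140 := by
    have e : (u : ℝ) / 2 ^ 140 + 1 / 2 ^ 140 = (((u : ℝ) + 1) * 2 ^ (CB - 140)) / A := by
      rw [hAB]; field_simp
    rw [e, ht0def]
    exact div_le_div_of_nonneg_right hu2r.le hA.le
  have hgrid : |t0 - (u : ℝ) / 2 ^ 140| ≤ 1 / 2 ^ 140 := by
    rw [abs_le]; constructor <;> linarith [show (0:ℝ) < 1 / 2 ^ 140 by positivity]
  have h140_60 : (1 : ℝ) / 2 ^ 140 + 1 / 2 ^ 64 ≤ 1 / 2 ^ 60 := by norm_num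
  have hγu : ∀ γ ∈ Set.Icc (t0 - rad) (t0 + rad), |γ - (u : ℝ) / 2 ^ 140| ≤ 1 / 2 ^ 60 := by
    intro γ hγ
    have h1 : |γ - t0| ≤ rad := by rw [abs_le]; constructor <;> linarith [hγ.1, hγ.2]
    calc |γ - (u : ℝ) / 2 ^ 140| = |(γ - t0) + (t0 - (u : ℝ) / 2 ^ 140)| := by ring_nf
      _ ≤ |γ - t0| + |t0 - (u : ℝ) / 2 ^ 140| := abs_add_le _ _
      _ ≤ 1 / 2 ^ 60 := by linarith [rad_le]
  -- `t 2^140 ∈ [u-2, u+2]` at both ends of the bracket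
  have hends : ∀ t ∈ Set.Icc (t0 - rad) (t0 + rad), (u : ℝ) - 2 ≤ t * 2 ^ 140 ∧ t * 2 ^ 140 ≤ (u : ℝ) + 2 := by
    intro t ht
    have hr140 : rad * 2 ^ 140 ≤ 1 := by
      rw [hrad, div_mul_eq_mul_div, div_le_one hA, hAdef]
      calc (16 : ℝ) * 2 ^ 140 = 2 ^ 144 := by norm_num
        _ ≤ 2 ^ CB := pow_le_pow_right₀ (by norm_num) le_CB
    have e1 : t0 * 2 ^ 140 - (u : ℝ) ∈ Set.Icc (0 : ℝ) 1 := by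
      constructor
      · have := mul_le_mul_of_nonneg_right hgrid1 hB.le
        rw [div_mul_cancel₀ _ hB.ne'] at this; linarith
      · have := mul_le_mul_of_nonneg_right hgrid2 hB.le
        rw [add_mul, div_mul_cancel₀ _ hB.ne', div_mul_cancel₀ _ hB.ne'] at this; linarith
    constructor
    · have := mul_le_mul_of_nonneg_right ht.1 hB.le
      rw [sub_mul] at this; linarith [e1.1]
    · have := mul_le_mul_of_nonneg_right ht.2 hB.le
      rw [add_mul] at this; linarith [e1.2]
  -- unfold the computation
  unfold zeroCheck at h
  split at h
  · rename_i W DB M R hW hDB hMR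
    split at h
    · rename_i Eφ hEφ
      split_ifs at h with hcond
      obtain ⟨hstir, hrot⟩ := hcond
      -- `W ∋ ζ(½ + it₀)`
      have hs0 : (1 / 2 : ℂ) + t0 * I ≠ 1 := fun h ↦ by
        have := congrArg Complex.im h; simp at this; linarith
      have hin : MC.mem Th.S (1 / 2 + t0 * I) ⟨halfAt S, MI.ofScaled ((c : ℤ) * 2 ^ (SB - CB))⟩ := by
        rw [hThS]; apply mem_inputHi
        rw [ht0def, hAdef, S_real]; push_cast; rw [two_SB_CB]; field_simp
      have hWm := mem_zetaBox hTh hin hs0 hW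
      rw [hThS] at hWm
      -- `DB ∋ ζ'(½ + it₀)` and `DB ∋ ζ'(½ + iγ)` on the bracket
      have hD0 := mem_derivBox hTl hTlS hu8 huT hDB (γ := t0)
        (by have := hgrid; calc |t0 - (u:ℝ)/2^140| ≤ 1/2^140 := this
              _ ≤ 1 / 2 ^ 60 := by norm_num)
      -- the rotation
      set φ : ℝ := (M.lo : ℝ) / SD with hφdef
      have hφS : φ = (((M.lo * 2 ^ (SB - 200) : ℤ)) : ℝ) / S := by
        rw [hφdef, S_real', SD_real']; push_cast; field_simp
      have hpiH : MI.mem S Real.pi Th.piI := hThS ▸ hTh.mem_pi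
      have hE : MC.mem S (cexp (φ * I)) Eφ := by
        have := MC.mem_expI S_pos hpiH hEφ (θ := φ) (by rw [hφS]; exact MI.mem_ofScaled S_pos _)
        simpa using this
      -- Stirling at both ends
      have hφ₁ : |φ - riemannSiegelTheta (t0 - rad)| < Real.pi / 2 :=
        abs_sub_riemannSiegelTheta_lt_of_stirling (by linarith)
          (stirling_sound hTl hTlS hu8 hMR hstir (hends _ ⟨le_rfl, by linarith [rad_pos]⟩))
      have hφ₂ : |φ - riemannSiegelTheta (t0 + rad)| < Real.pi / 2 :=
        abs_sub_riemannSiegelTheta_lt_of_stirling (by linarith [rad_pos])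
          (stirling_sound hTl hTlS hu8 hMR hstir (hends _ ⟨by linarith [rad_pos], le_rfl⟩))
      -- the sign conditions
      have hrs := rotSignOk_sound hrot hE hWm hD0
      have hES := errE_mul_S_le (t := t0) (by linarith) (by linarith [rad_pos])
      have hSr : (0 : ℝ) < S := by exact_mod_cast S_pos
      set E : ℝ := 2 * (t0 + 15) ^ 3 * rad ^ 2 with hEdef
      have hE1 : E ≤ 1 / S := by rw [le_div_iff₀ hSr]; exact hES
      have hsign := hardyZ_mul_hardyZ_neg_of_center h8t0 rad_pos
        (rad_le.trans (by norm_num)) hφ₁ hφ₂ (by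
          rcases hrs with ⟨h1, h2⟩ | ⟨h1, h2⟩
          · left
            constructor
            · have key := (lt_div_iff₀ hSr).2 h1
              rw [neg_div] at key
              linarith
            · have key := (div_lt_iff₀ hSr).2 h2
              linarith
          · right
            constructor
            · have key := (div_lt_iff₀ hSr).2 h1
              linarith
            · have key := (lt_div_iff₀ hSr).2 h2
              rw [neg_div] at key
              linarith)
      refine ⟨hsign, fun γ hγ ↦ ?_⟩
      -- the summands
      have hγ0 : 0 ≤ γ := by linarith [hγ.1]
      have hγT : γ ≤ Mertens.heightT0 := by linarith [hγ.2]
      have hDγ := mem_derivBox hTl hTlS hu8 huT hDB (hγu γ hγ)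
      have hγ' : γ ∈ Set.Icc (((c : ℝ) - 16) / 2 ^ CB) (((c : ℝ) + 16) / 2 ^ CB) := by
        rw [← hAdef, sub_div, add_div, ← ht0def, ← hrad]; exact hγ
      exact termsOf_sound hTh hThS h hγ' hγ0 hγT hDγ
    · simp at h
  · simp at h

/-! ### One block -/

/-- The ordering check, read off. [folklore] -/
lemma orderOk_sound {j : ℕ} (h : orderOk D j = true) :
    8 * 2 ^ CB + 16 ≤ ctr D j ∧ ctr D j + 16 < Mertens.heightT0 * 2 ^ CB ∧
      (j + 1 < NZ → ctr D j + 32 < ctr D (j + 1)) :=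
  of_decide_eq_true h

/-- Soundness of `chunkSums`. [folklore] -/
theorem chunkSums_sound {Th Tl : Tables} (hTh : Th.Valid) (hThS : Th.S = S) (hTl : Tl.Valid)
    (hTlS : Tl.S = SD) (k : ℕ) :
    ∀ (i : ℕ) {sl sh : ℤ}, chunkSums D Th Tl k i = some (sl, sh) →
      (∀ i' < i, orderOk D (k * CHUNK + i') = true ∧
        hardyZ (t₀ D (k * CHUNK + i') - rad) * hardyZ (t₀ D (k * CHUNK + i') + rad) < 0) ∧
      ∀ γ : ℕ → ℝ, (∀ i' < i, γ (k * CHUNK + i') ∈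
          Set.Icc (t₀ D (k * CHUNK + i') - rad) (t₀ D (k * CHUNK + i') + rad)) →
        (sl : ℝ) ≤ (∑ i' ∈ Finset.range i, term D.yPlus (γ (k * CHUNK + i'))) * S ∧
          (∑ i' ∈ Finset.range i, term D.yMinus (γ (k * CHUNK + i'))) * S ≤ sh
  | 0, sl, sh, h => by
    simp only [chunkSums, Option.some.injEq, Prod.mk.injEq] at h
    obtain ⟨rfl, rfl⟩ := h
    refine ⟨fun i' hi' ↦ absurd hi' (Nat.not_lt_zero _), fun γ _ ↦ ?_⟩
    simp only [Finset.sum_range_zero, zero_mul, Int.cast_zero, le_refl, and_self]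
  | i + 1, sl, sh, h => by
    simp only [chunkSums] at h
    split at h
    · simp at h
    · rename_i sl0 sh0 hprev
      split_ifs at h with hord
      split at h
      · rename_i vlo vhi hz
        simp only [Option.some.injEq, Prod.mk.injEq] at h
        obtain ⟨rfl, rfl⟩ := h
        obtain ⟨ih1, ih2⟩ := chunkSums_sound hTh hThS hTl hTlS k i hprev
        obtain ⟨hc8, hcT, -⟩ := orderOk_sound hord
        obtain ⟨hsign, hbd⟩ := zeroCheck_sound hTh hThS hTl hTlS hc8 hcT hz
        refine ⟨fun i' hi' ↦ ?_, fun γ hγ ↦ ?_⟩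
        · rcases Nat.lt_succ_iff_lt_or_eq.1 hi' with hlt | heq
          · exact ih1 i' hlt
          · subst heq
            exact ⟨hord, hsign⟩
        · obtain ⟨hs1, hs2⟩ := ih2 γ fun i' hi' ↦ hγ i' (Nat.lt_succ_of_lt hi')
          have hγi := hγ i (Nat.lt_succ_self i)
          obtain ⟨hb1, hb2⟩ := hbd (γ (k * CHUNK + i)) hγi
          rw [Finset.sum_range_succ, Finset.sum_range_succ, add_mul, add_mul]
          push_cast
          constructor <;> linarith
      · simp at h

/-- What a passed block check (with valid tables) gives. [folklore] -/
theorem checkChunkWith_sound {Th Tl : Tables} (hTh : Th.Valid) (hThS : Th.S = S) (hTl : Tl.Valid)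
    (hTlS : Tl.S = SD) {b : ℤ × ℤ} {k : ℕ} (h : checkChunkWith D Th Tl b k = true) :
    (∀ i < CHUNK, orderOk D (k * CHUNK + i) = true ∧
      hardyZ (t₀ D (k * CHUNK + i) - rad) * hardyZ (t₀ D (k * CHUNK + i) + rad) < 0) ∧
    ∀ γ : ℕ → ℝ, (∀ i < CHUNK, γ (k * CHUNK + i) ∈
        Set.Icc (t₀ D (k * CHUNK + i) - rad) (t₀ D (k * CHUNK + i) + rad)) →
      (b.1 : ℝ) / 2 ^ 60 ≤ ∑ i ∈ Finset.range CHUNK, term D.yPlus (γ (k * CHUNK + i)) ∧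
        ∑ i ∈ Finset.range CHUNK, term D.yMinus (γ (k * CHUNK + i)) ≤ (b.2 : ℝ) / 2 ^ 60 := by
  unfold checkChunkWith at h
  generalize hcs : chunkSums D Th Tl k CHUNK = r at h
  rcases r with _ | ⟨sl, sh⟩
  · simp [boundsOk] at h
  · simp only [boundsOk, decide_eq_true_eq] at h
    obtain ⟨h1, h2⟩ := chunkSums_sound hTh hThS hTl hTlS k CHUNK hcs
    refine ⟨h1, fun γ hγ ↦ ?_⟩
    obtain ⟨hs1, hs2⟩ := h2 γ hγ
    have e1 : ((b.1 : ℤ) : ℝ) * 2 ^ (SB - 60) ≤ sl := by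
      have := Int.cast_le (R := ℝ) |>.2 h.1
      push_cast at this; exact this
    have e2 : (sh : ℝ) ≤ ((b.2 : ℤ) : ℝ) * 2 ^ (SB - 60) := by
      have := Int.cast_le (R := ℝ) |>.2 h.2
      push_cast at this; exact this
    rw [S_real''] at hs1 hs2
    have hp : (0 : ℝ) < 2 ^ (SB - 60) := pow_pos (by norm_num) _
    have h60 : (0 : ℝ) < 2 ^ 60 := pow_pos (by norm_num) _
    constructor
    · rw [div_le_iff₀ h60]
      have key : ((b.1 : ℤ) : ℝ) * 2 ^ (SB - 60) ≤
          (∑ i ∈ Finset.range CHUNK, term D.yPlus (γ (k * CHUNK + i))) * 2 ^ 60 * 2 ^ (SB - 60) := by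
        linarith
      exact le_of_mul_le_mul_right key hp
    · rw [le_div_iff₀ h60]
      have key : (∑ i ∈ Finset.range CHUNK, term D.yMinus (γ (k * CHUNK + i))) * 2 ^ 60 * 2 ^ (SB - 60) ≤
          ((b.2 : ℤ) : ℝ) * 2 ^ (SB - 60) := by
        linarith
      exact le_of_mul_le_mul_right key hp

/-- What a passed block check gives. [folklore] -/
theorem checkChunk_sound {b : ℤ × ℤ} {k : ℕ} (h : checkChunk D b k = true) :
    (∀ i < CHUNK, orderOk D (k * CHUNK + i) = true ∧
      hardyZ (t₀ D (k * CHUNK + i) - rad) * hardyZ (t₀ D (k * CHUNK + i) + rad) < 0) ∧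
    ∀ γ : ℕ → ℝ, (∀ i < CHUNK, γ (k * CHUNK + i) ∈
        Set.Icc (t₀ D (k * CHUNK + i) - rad) (t₀ D (k * CHUNK + i) + rad)) →
      (b.1 : ℝ) / 2 ^ 60 ≤ ∑ i ∈ Finset.range CHUNK, term D.yPlus (γ (k * CHUNK + i)) ∧
        ∑ i ∈ Finset.range CHUNK, term D.yMinus (γ (k * CHUNK + i)) ≤ (b.2 : ℝ) / 2 ^ 60 := by
  unfold checkChunk at h
  generalize hH : tabHi = oh at h
  generalize hL : tabLo = ol at h
  rcases oh with _ | Th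
  · simp only [Option.bind_none, Option.getD_none] at h
    exact absurd h Bool.false_ne_true
  · rcases ol with _ | Tl
    · simp only [Option.bind_some, Option.map_none, Option.getD_none] at h
      exact absurd h Bool.false_ne_true
    · simp only [Option.bind_some, Option.map_some, Option.getD_some] at h
      exact checkChunkWith_sound (tabHi_valid hH) (tabHi_S hH) (tabLo_valid hL) (tabLo_S hL) h

/-! ### Assembly -/

/-- The final check, read in `ℝ`. [folklore] -/
lemma final_of_checkFinal {bnds : ℕ → ℤ × ℤ} (h : checkFinal bnds = true) :
    (1.6383 : ℝ) < (sumL bnds : ℝ) / 2 ^ 60 ∧ (sumU bnds : ℝ) / 2 ^ 60 < -1.6383 := by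
  obtain ⟨h1, h2⟩ := of_decide_eq_true h
  have h1' : (16383 : ℝ) * 2 ^ 60 < 10000 * sumL bnds := by exact_mod_cast h1
  have h2' : (10000 : ℝ) * sumU bnds < -16383 * 2 ^ 60 := by exact_mod_cast h2
  constructor
  · rw [lt_div_iff₀ (by positivity)]; norm_num; linarith
  · rw [div_lt_iff₀ (by positivity)]; norm_num; linarith

/-- **Soundness of the whole certificate**: the block checks, the final check and the (already
certified) top-edge count `N(2516) = 2000` give a height `T = 2516` below which every zero of `ζ`
in the critical strip is simple and on the line, and two values of `y` with `Re h_K(y, T) > 1.6383`,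
`Re h_K(y, T) < -1.6383`. [cite: BestTrudgian2015, Theorem 1] -/
theorem numerics_of_checks {bnds : ℕ → ℤ × ℤ} (hTop : Mertens.checkTop = true)
    (hFin : checkFinal bnds = true) (hCh : ∀ k < NCHUNK, checkChunk D (bnds k) k = true) :
    ∃ T : ℝ, 0 < T ∧
      (∀ ρ : ℂ, riemannZeta ρ = 0 → 0 < ρ.re → ρ.re < 1 → |ρ.im| < T →
        ρ.re = 1 / 2 ∧ deriv riemannZeta ρ ≠ 0) ∧
      (∃ y : ℝ, (1.6383 : ℝ) <
        (inghamSum (fun t : ℝ => (jurkatPeyerimhoffKernel (t / T) : ℂ)) T y).re) ∧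
      (∃ y : ℝ,
        (inghamSum (fun t : ℝ => (jurkatPeyerimhoffKernel (t / T) : ℂ)) T y).re < -1.6383) := by
  classical
  have hNZ : NZ = NCHUNK * CHUNK := by unfold NZ NCHUNK CHUNK; norm_num
  have hT0 : (Mertens.heightT0 : ℝ) = 2516 := heightT0_real
  -- per-zero facts
  have hfact : ∀ j < NZ, orderOk D j = true ∧
      hardyZ (t₀ D j - rad) * hardyZ (t₀ D j + rad) < 0 := by
    intro j hj
    have hk : j / CHUNK < NCHUNK := by
      rw [hNZ] at hj; exact Nat.div_lt_of_lt_mul (by rwa [mul_comm] at hj)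
    have hi : j % CHUNK < CHUNK := Nat.mod_lt _ (by unfold CHUNK; norm_num)
    have := (checkChunk_sound (hCh _ hk)).1 (j % CHUNK) hi
    rwa [Nat.div_add_mod'] at this
  have hA : (0 : ℝ) < 2 ^ CB := pow_pos (by norm_num) _
  have hord : ∀ j < NZ, 8 ≤ t₀ D j - rad ∧ t₀ D j + rad < Mertens.heightT0 ∧
      (j + 1 < NZ → t₀ D j + rad < t₀ D (j + 1) - rad) := by
    intro j hj
    obtain ⟨h1, h2, h3⟩ := orderOk_sound (hfact j hj).1
    have h1r : (8 : ℝ) * 2 ^ CB + 16 ≤ ctr D j := by exact_mod_cast h1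
    have h2r : (ctr D j : ℝ) + 16 < Mertens.heightT0 * 2 ^ CB := by exact_mod_cast h2
    refine ⟨?_, ?_, fun hj1 ↦ ?_⟩
    · unfold t₀ rad; rw [← sub_div, le_div_iff₀ hA]; linarith
    · unfold t₀ rad; rw [← add_div, div_lt_iff₀ hA]; linarith
    · have h3r : (ctr D j : ℝ) + 32 < ctr D (j + 1) := by exact_mod_cast h3 hj1
      unfold t₀ rad; rw [← add_div, ← sub_div, div_lt_div_iff_of_pos_right hA]; linarith
  -- the bracketing over `Fin NZ`
  have hB : ZeroBracketing NZ (Mertens.heightT0 : ℝ) (fun j : Fin NZ ↦ t₀ D j - rad)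
      (fun j : Fin NZ ↦ t₀ D j + rad) := by
    refine ZeroBracketing.of_hardyZ_sign (fun j ↦ by linarith [rad_pos]) (fun j k hjk ↦ ?_)
      (fun j ↦ by linarith [(hord j j.2).1]) (fun j ↦ (hord j j.2).2.1) (fun j ↦ (hfact j j.2).2)
    -- separation by induction along the chain
    have hjk' : (j : ℕ) < k := hjk
    have hsep : ∀ a b : ℕ, a < b → b < NZ → t₀ D a + rad < t₀ D b - rad := by
      intro a b hab hb
      induction b with
      | zero => exact absurd hab (Nat.not_lt_zero _)
      | succ b ih =>
        rcases Nat.lt_succ_iff_lt_or_eq.1 hab with hlt | heq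
        · have := ih hlt (by omega)
          have h2 := (hord b (by omega)).2.2 hb
          linarith [rad_pos]
        · subst heq; exact (hord a (by omega)).2.2 hb
    exact hsep j k hjk' k.2
  have hTpos : (0 : ℝ) < Mertens.heightT0 := by rw [hT0]; norm_num
  have hN : zetaZeroCount (Mertens.heightT0 : ℝ) ≤ NZ := by
    rw [Mertens.zetaZeroCount_of_checkTop hTop]; unfold NZ; exact le_rfl
  -- the sums
  have hsum : ∀ y : ℤ, (inghamSum (fun t : ℝ ↦ (jurkatPeyerimhoffKernel (t / Mertens.heightT0) : ℂ))
      Mertens.heightT0 (y : ℝ)).re = ∑ k ∈ Finset.range NCHUNK, ∑ i ∈ Finset.range CHUNK,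
        term y (hB.ordinate ⟨(k * CHUNK + i) % NZ, Nat.mod_lt _ NZ_pos⟩) := by
    intro y
    rw [hB.re_inghamSum_eq hTpos.le hN (y : ℝ)]
    set f : ℕ → ℝ := fun j ↦ term y (hB.ordinate ⟨j % NZ, Nat.mod_lt _ NZ_pos⟩) with hf
    have e1 : ∑ j : Fin NZ, 2 * (inghamTerm (fun t : ℝ ↦ (jurkatPeyerimhoffKernel (t / Mertens.heightT0) : ℂ))
        (y : ℝ) (hB.ordinate j)).re = ∑ j : Fin NZ, f j := by
      refine Finset.sum_congr rfl fun j _ ↦ ?_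
      have ej : (⟨(j : ℕ) % NZ, Nat.mod_lt _ NZ_pos⟩ : Fin NZ) = j := Fin.ext (Nat.mod_eq_of_lt j.2)
      simp only [hf, ej]
      rfl
    rw [e1, Fin.sum_univ_eq_sum_range f NZ]
    calc ∑ i ∈ Finset.range NZ, f i = ∑ i ∈ Finset.range (NCHUNK * CHUNK), f i := by rw [← hNZ]
      _ = ∑ k ∈ Finset.range NCHUNK, ∑ i ∈ Finset.range CHUNK, f (k * CHUNK + i) :=
          Mertens.sum_range_mul f NCHUNK CHUNK
      _ = _ := by simp only [hf]
  have hbounds : ∀ k < NCHUNK,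
      ((bnds k).1 : ℝ) / 2 ^ 60 ≤ ∑ i ∈ Finset.range CHUNK,
          term D.yPlus (hB.ordinate ⟨(k * CHUNK + i) % NZ, Nat.mod_lt _ NZ_pos⟩) ∧
      ∑ i ∈ Finset.range CHUNK,
          term D.yMinus (hB.ordinate ⟨(k * CHUNK + i) % NZ, Nat.mod_lt _ NZ_pos⟩) ≤
        ((bnds k).2 : ℝ) / 2 ^ 60 := by
    intro k hk
    refine (checkChunk_sound (hCh k hk)).2
      (fun j ↦ hB.ordinate ⟨j % NZ, Nat.mod_lt _ NZ_pos⟩) fun i hi ↦ ?_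
    have hlt : k * CHUNK + i < NZ := by
      rw [hNZ]
      calc k * CHUNK + i < k * CHUNK + CHUNK := by omega
        _ = (k + 1) * CHUNK := by ring
        _ ≤ NCHUNK * CHUNK := Nat.mul_le_mul_right _ hk
    have e : (⟨(k * CHUNK + i) % NZ, Nat.mod_lt _ NZ_pos⟩ : Fin NZ) = ⟨k * CHUNK + i, hlt⟩ :=
      Fin.ext (Nat.mod_eq_of_lt hlt)
    simp only [e]
    exact ⟨hB.le_ordinate ⟨k * CHUNK + i, hlt⟩, hB.ordinate_le ⟨k * CHUNK + i, hlt⟩⟩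
  obtain ⟨hFL, hFU⟩ := final_of_checkFinal hFin
  refine ⟨Mertens.heightT0, hTpos, hB.zero_clause hTpos.le hN, ⟨D.yPlus, ?_⟩, ⟨D.yMinus, ?_⟩⟩
  · rw [hsum]
    refine hFL.trans_le ?_
    unfold sumL
    push_cast
    rw [Finset.sum_div]
    exact Finset.sum_le_sum fun k hk ↦ (hbounds k (Finset.mem_range.1 hk)).1
  · rw [hsum]
    refine lt_of_le_of_lt ?_ hFU
    unfold sumU
    push_cast
    rw [Finset.sum_div]
    exact Finset.sum_le_sum fun k hk ↦ (hbounds k (Finset.mem_range.1 hk)).2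

end Soundness

/-! The checks are evaluated only by `native_decide` (block files); make them opaque to the
elaborator so that stating `checkChunk D k = true` never unfolds the computation. -/
attribute [irreducible] checkChunk checkFinal

end Literature.NumberTheory.LFunctions.ZetaNumerics.MertensBT
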